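import Summits.ResolutionOfSingularities.ResolutionOfSingularities.Theorems.HilbertSamuelEliminationSigmaMaxModificationsCorridor3CPFrameChartRegular
import Literature.AlgebraicGeometry.Resolution.BlowupAlgebraQuasiRegularChart
import HarnessLib

/-!
# [OURS · L1 W4.2] D18 (G8): an r.s.p. of `R[(z)/z_{j₀}]_𝔮` ADAPTED to the transformed boundary — `z_{j₀}` (exceptional), the `z_k/z_{j₀}`
# lying in `𝔮` (old members through the point), the transversal parameters `y`, completed by fresh parameters (de Jong's chart r.s.p.)
# (cell res-hironaka, LADDER-RESOLUTION rung L; slot W4.2, crux chain w42 `SigmaMaxModificationsCorridor3` stmt-ResolutionOfSingularities-19249;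
# `--supports stmt-ResolutionOfSingularities-19249 --as helper`; res-L1-w42-plan-1 RULING v3.14-42 part 2 (KG)(2) «(G8) E-adapted propagation»;
# hand res-D-brk-3 (gen 7), file F2c-rsop of DESIGN 17:06:09Z)

PURE COMMUTATIVE ALGEBRA, 0 `def`s, every declaration PROVED; OURS bookkeeping; NOT a statement of Hironaka's manuscript [Hironaka2017] nor of
[CossartJannsenSaito2020]/[CossartPiltant2019]. AI-written, weaker than expert review.

* `exists_adapted_rsop_localization_blowupAlgebra` — `R` regular local of dimension `d + l` with r.s.p. `(z, y)`, `S = R[(z)/z_{j₀}]`, `𝔮` a prime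
  of `S` over `𝔪_R` with `dim S_𝔮 = d + l` (a closed point of the fibre): there are `z' : Fin d → S_𝔮`, `y' : Fin l → S_𝔮` with
  `((z', y')) = 𝔪_{S_𝔮}`, `z'_{j₀} = z_{j₀}`, `z'_k = z_k/z_{j₀}` whenever `k ≠ j₀` and `z_k/z_{j₀} ∈ 𝔮`, and `y' = y` — the tree's de Jong r.s.p.
  `isRsopPart_chartFamily_reesChart` (`BlowupChartRsop`, [DeJong1996, 2.4]) transported along `reesChartEquiv`, the unconstrained slots filled by
  the complementary parameters it provides. INDEX-PRESERVING: the old frame index of a boundary member is the new frame index of its transform.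

References: de Jong 1996, 2.4 [DeJong1996]; Stacks 0804 [StacksProject]; CP 2019 Prop. 2.7 (last statement) [CossartPiltant2019].
-/

noncomputable section

set_option linter.dupNamespace false

open IsLocalRing IsLocalization
open Literature.AlgebraicGeometry.Resolution

universe u

namespace Summit.ResolutionOfSingularities.ResolutionOfSingularities.Theorems.SigmaMaxModificationsCorridor3.Helpers

variable {R : Type u} [CommRing R] [IsRegularLocalRing R]

set_option maxHeartbeats 800000 in
-- instance unification on the Rees chart ring `chartRing z j₀` is slow (as in `…CPFrameChartRegular`)
/-- [OURS · L1 W4.2] **An r.s.p. of `R[(z)/z_{j₀}]_𝔮` adapted to the transformed boundary, with the SAME indices.** See the module docstring.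
[cite: DeJong1996, 2.4] [cite: StacksProject, Tag 0804] -/
theorem exists_adapted_rsop_localization_blowupAlgebra {d l : ℕ} (hdim : ringKrullDim R = (d + l : ℕ))
    (z : Fin d → R) (y : Fin l → R) (hzy : Ideal.span (Set.range (Fin.append z y)) = maximalIdeal R) (j₀ : Fin d)
    (𝔮 : Ideal (blowupAlgebra (Ideal.span (Set.range z)) (z j₀))) [𝔮.IsPrime]
    (h𝔮 : 𝔮.comap (algebraMap R (blowupAlgebra (Ideal.span (Set.range z)) (z j₀))) = maximalIdeal R)
    (hdimL : ringKrullDim (Localization.AtPrime 𝔮) = (d + l : ℕ)) :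
    ∃ (z' : Fin d → Localization.AtPrime 𝔮) (y' : Fin l → Localization.AtPrime 𝔮),
      Ideal.span (Set.range (Fin.append z' y')) = maximalIdeal (Localization.AtPrime 𝔮) ∧
      z' j₀ = algebraMap _ (Localization.AtPrime 𝔮) (algebraMap R (blowupAlgebra (Ideal.span (Set.range z)) (z j₀)) (z j₀)) ∧
      (∀ k, k ≠ j₀ → blowupAlgebra.gen (Ideal.span (Set.range z)) (z j₀) (z k) (Ideal.mem_span_range_self (f := z) (x := k)) ∈ 𝔮 →
        z' k = algebraMap _ (Localization.AtPrime 𝔮)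
          (blowupAlgebra.gen (Ideal.span (Set.range z)) (z j₀) (z k) (Ideal.mem_span_range_self (f := z) (x := k)))) ∧
      (∀ i, y' i = algebraMap _ (Localization.AtPrime 𝔮) (algebraMap R (blowupAlgebra (Ideal.span (Set.range z)) (z j₀)) (y i))) := by
  classical
  -- the Rees chart `chartRing z j₀ ≅ (blowupAlgebra (Ideal.span (Set.range z)) (z j₀))` and the prime `𝔓` corresponding to `𝔮`
  set ε : chartRing z j₀ ≃+* (blowupAlgebra (Ideal.span (Set.range z)) (z j₀)) :=
    reesChartEquiv (I := Ideal.span (Set.range z)) (z j₀) (Ideal.mem_span_range_self (f := z) (x := j₀)) with hε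
  have hεbase : ∀ r : R, ε (chartBase z j₀ r) = algebraMap R _ r := fun r => reesChartEquiv_reesChartBase (z j₀) _ r
  have hεgen : ∀ k, ε (chartGen z j₀ k) = blowupAlgebra.gen (Ideal.span (Set.range z)) (z j₀) (z k)
      (Ideal.mem_span_range_self (f := z) (x := k)) := fun k => reesChartEquiv_chartGen z j₀ k
  set 𝔓 : Ideal (chartRing z j₀) := 𝔮.comap ε.toRingHom with h𝔓
  haveI : 𝔓.IsPrime := Ideal.comap_isPrime _ _
  letI algC : Algebra (chartRing z j₀) (Localization.AtPrime 𝔮) := ((algebraMap (blowupAlgebra (Ideal.span (Set.range z)) (z j₀)) (Localization.AtPrime 𝔮)).comp ε.symm.symm.toRingHom).toAlgebra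
  have halgC : ∀ x : chartRing z j₀, algebraMap (chartRing z j₀) (Localization.AtPrime 𝔮) x =
      algebraMap (blowupAlgebra (Ideal.span (Set.range z)) (z j₀)) (Localization.AtPrime 𝔮) (ε x) := fun x => by
    change ((algebraMap (blowupAlgebra (Ideal.span (Set.range z)) (z j₀)) (Localization.AtPrime 𝔮)).comp
      ε.symm.symm.toRingHom) x = _
    rfl
  have hM : 𝔮.primeCompl.map ε.symm = 𝔓.primeCompl := by
    ext w
    simp only [Submonoid.mem_map, Ideal.mem_primeCompl_iff]
    constructor
    · rintro ⟨x, hx, rfl⟩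
      intro hw
      apply hx
      have : ε (ε.symm x) ∈ 𝔮 := hw
      rwa [ε.apply_symm_apply] at this
    · intro hw
      refine ⟨ε w, fun hx => hw ?_, ?_⟩
      · change ε.toRingHom w ∈ 𝔮
        exact hx
      · exact ε.symm_apply_apply w
  haveI hloc : IsLocalization.AtPrime (Localization.AtPrime 𝔮) 𝔓 := by
    have h := IsLocalization.isLocalization_of_base_ringEquiv 𝔮.primeCompl (Localization.AtPrime 𝔮) (P := chartRing z j₀) ε.symm
    change IsLocalization _ _
    rwa [hM] at h
  have h𝔓R : 𝔓.comap (chartBase z j₀) = maximalIdeal R := by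
    rw [h𝔓, Ideal.comap_comap]
    have : ε.toRingHom.comp (chartBase z j₀) = algebraMap R (blowupAlgebra (Ideal.span (Set.range z)) (z j₀)) := RingHom.ext fun r => hεbase r
    rw [this, h𝔮]
  have hd : (maximalIdeal R).spanFinrank = d + l :=
    Literature.AlgebraicGeometry.Resolution.CossartPiltant.spanFinrank_maximalIdeal_eq_of_ringKrullDim_eq hdim
  -- the old members through the point: `A = {k ≠ j₀ | z_k/z_{j₀} ∈ 𝔮}`; the free slots `F`
  set A : Finset (Fin d) := Finset.univ.filter fun k => k ≠ j₀ ∧ chartGen z j₀ k ∈ 𝔓 with hA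
  set F : Finset (Fin d) := Finset.univ.filter fun k => k ≠ j₀ ∧ chartGen z j₀ k ∉ 𝔓 with hF
  have hmemA : ∀ k, k ∈ A ↔ k ≠ j₀ ∧ chartGen z j₀ k ∈ 𝔓 := fun k => by simp [hA]
  have hmemF : ∀ k, k ∈ F ↔ k ≠ j₀ ∧ chartGen z j₀ k ∉ 𝔓 := fun k => by simp [hF]
  let jJ : Fin A.card → {k : Fin d // k ≠ j₀} := fun i => ⟨(A.equivFin.symm i).1, ((hmemA _).mp (A.equivFin.symm i).2).1⟩
  have hjJ : Function.Injective jJ := fun i i' h => by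
    apply A.equivFin.symm.injective
    apply Subtype.ext
    simpa [jJ] using congrArg Subtype.val h
  have hjJmem : ∀ i, chartGen z j₀ (jJ i).1 ∈ 𝔓 := fun i => ((hmemA _).mp (A.equivFin.symm i).2).2
  -- de Jong: the chart family is part of an r.s.p. of `(Localization.AtPrime 𝔮)`
  obtain ⟨hregL, e, yf, hdimL', hspanL⟩ := isRsopPart_chartFamily_reesChart z j₀ y hzy hd 𝔓 h𝔓R (Localization.AtPrime 𝔮) jJ hjJ hjJmem
  haveI := hregL
  -- counting: `|F| = e`
  have hAF : A.card + F.card + 1 = d := by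
    have h1 : A.card + F.card = (Finset.univ.filter fun k : Fin d => k ≠ j₀).card := by
      rw [hA, hF, ← Finset.filter_filter, ← Finset.filter_filter, Finset.card_filter_add_card_filter_not]
    rw [h1, Finset.filter_ne' Finset.univ j₀, Finset.card_erase_of_mem (Finset.mem_univ _), Finset.card_univ, Fintype.card_fin]
    have : 0 < d := Fin.pos j₀
    omega
  have hFe : F.card = e := by
    have h1 : ((A.card + l + 1 + e : ℕ) : WithBot ℕ∞) = ((d + l : ℕ) : WithBot ℕ∞) := by rw [← hdimL', ← hdimL]
    have h2 : A.card + l + 1 + e = d + l := by exact_mod_cast h1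
    omega
  -- the adapted family
  let z' : Fin d → (Localization.AtPrime 𝔮) := fun k =>
    if hk0 : k = j₀ then algebraMap (blowupAlgebra (Ideal.span (Set.range z)) (z j₀)) (Localization.AtPrime 𝔮) (algebraMap R (blowupAlgebra (Ideal.span (Set.range z)) (z j₀)) (z j₀))
    else if hk : chartGen z j₀ k ∈ 𝔓 then algebraMap (blowupAlgebra (Ideal.span (Set.range z)) (z j₀)) (Localization.AtPrime 𝔮) (ε (chartGen z j₀ k))
    else yf (Fin.cast hFe (F.equivFin ⟨k, (hmemF k).mpr ⟨hk0, hk⟩⟩))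
  let y' : Fin l → (Localization.AtPrime 𝔮) := fun i => algebraMap (blowupAlgebra (Ideal.span (Set.range z)) (z j₀)) (Localization.AtPrime 𝔮) (algebraMap R (blowupAlgebra (Ideal.span (Set.range z)) (z j₀)) (y i))
  have hz'0 : z' j₀ = algebraMap (blowupAlgebra (Ideal.span (Set.range z)) (z j₀)) (Localization.AtPrime 𝔮) (algebraMap R (blowupAlgebra (Ideal.span (Set.range z)) (z j₀)) (z j₀)) := by simp [z']
  have hz'A : ∀ k, k ≠ j₀ → chartGen z j₀ k ∈ 𝔓 → z' k = algebraMap (blowupAlgebra (Ideal.span (Set.range z)) (z j₀)) (Localization.AtPrime 𝔮) (ε (chartGen z j₀ k)) := fun k hk0 hk => by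
    simp [z', hk0, hk]
  have hz'F : ∀ (k) (hk0 : k ≠ j₀) (hk : chartGen z j₀ k ∉ 𝔓), z' k = yf (Fin.cast hFe (F.equivFin ⟨k, (hmemF k).mpr ⟨hk0, hk⟩⟩)) :=
    fun k hk0 hk => by simp [z', hk0, hk]
  refine ⟨z', y', ?_, hz'0, fun k hk0 hk => ?_, fun i => rfl⟩
  · -- the span
    apply le_antisymm
    · -- every member lies in `𝔪_L`
      rw [Ideal.span_le]
      rintro _ ⟨i, rfl⟩
      rw [SetLike.mem_coe, ← hspanL]
      induction i using Fin.addCases with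
      | left k =>
        rw [Fin.append_left]
        by_cases hk0 : k = j₀
        · subst hk0
          rw [hz'0]
          refine Ideal.subset_span (Or.inl ⟨0, ?_⟩)
          simp [chartFamily, halgC, hεbase]
        · by_cases hk : chartGen z j₀ k ∈ 𝔓
          · rw [hz'A k hk0 hk]
            obtain ⟨i, hi⟩ : ∃ i, jJ i = ⟨k, hk0⟩ := by
              refine ⟨A.equivFin ⟨k, (hmemA k).mpr ⟨hk0, hk⟩⟩, Subtype.ext ?_⟩
              simp [jJ]
            refine Ideal.subset_span (Or.inl ⟨Fin.succ (Fin.castAdd l i), ?_⟩)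
            simp only [chartFamily, Fin.cons_succ, Fin.append_left, halgC, hi]
          · rw [hz'F k hk0 hk]
            exact Ideal.subset_span (Or.inr ⟨_, rfl⟩)
      | right i =>
        rw [Fin.append_right]
        refine Ideal.subset_span (Or.inl ⟨Fin.succ (Fin.natAdd A.card i), ?_⟩)
        simp only [chartFamily, Fin.cons_succ, Fin.append_right, halgC, hεbase, y']
    · rw [← hspanL, Ideal.span_le]
      rintro w (⟨i, rfl⟩ | ⟨i, rfl⟩)
      · -- a member of the chart family
        refine Fin.cases ?_ (fun i => ?_) i
        · rw [chartFamily, Fin.cons_zero, halgC, hεbase, ← hz'0]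
          exact Ideal.subset_span ⟨Fin.castAdd l j₀, Fin.append_left z' y' j₀⟩
        · rw [chartFamily, Fin.cons_succ]
          induction i using Fin.addCases with
          | left i =>
            rw [Fin.append_left, halgC, ← hz'A (jJ i).1 (jJ i).2 (hjJmem i)]
            exact Ideal.subset_span ⟨Fin.castAdd l (jJ i).1, Fin.append_left z' y' _⟩
          | right i =>
            rw [Fin.append_right, halgC, hεbase]
            exact Ideal.subset_span ⟨Fin.natAdd d i, Fin.append_right z' y' i⟩
      · -- a fresh parameter
        set k : Fin d := (F.equivFin.symm (Fin.cast hFe.symm i)).1 with hk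
        have hkF := (hmemF k).mp (F.equivFin.symm (Fin.cast hFe.symm i)).2
        have hzk : z' k = yf i := by
          rw [hz'F k hkF.1 hkF.2]
          congr 1
          have : (⟨k, (hmemF k).mpr ⟨hkF.1, hkF.2⟩⟩ : {x // x ∈ F}) = F.equivFin.symm (Fin.cast hFe.symm i) := Subtype.ext rfl
          rw [this, Equiv.apply_symm_apply]
          ext; simp
        rw [SetLike.mem_coe, ← hzk]
        exact Ideal.subset_span ⟨Fin.castAdd l k, Fin.append_left z' y' k⟩
  · rw [hz'A k hk0 ?_, hεgen]
    rw [h𝔓, Ideal.mem_comap, RingEquiv.toRingHom_eq_coe, RingHom.coe_coe, hεgen]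
    exact hk

end Summit.ResolutionOfSingularities.ResolutionOfSingularities.Theorems.SigmaMaxModificationsCorridor3.Helpers

end
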